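import Summits.Ventures.CertifiedArithmetic.LowPrec.GemmThetaLawGenMixACheck1
import Summits.Ventures.CertifiedArithmetic.LowPrec.GemmThetaLawGenMixACheck2
import Summits.Ventures.CertifiedArithmetic.LowPrec.GemmThetaLawGenMixACheck3
import Summits.Ventures.CertifiedArithmetic.LowPrec.GemmThetaLawGenMixACheck4
import Summits.Ventures.CertifiedArithmetic.LowPrec.GemmThetaLawGenMixACheck5

/-!
# The E2M3×E2M1 mixed law check passes for every `p ≥ 10`

HONEST FRAMING (venture CertifiedArithmetic / cell `pub-lowprec`, seat gemm, gen 12 → 13): certified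
error envelopes and provably optimal rounding/accumulation schemes for low-precision formats under
stated cost models; every table by two implementations; no hardware or vendor claims.

`lawCheck_e2m3e2m1`: the letter-dependent symbolic θ-certificate check of the E2M3×E2M1 law
(`GemmThetaLawGenMixAData.e2m3e2m1Law`: ψ tables `B = (2,3,4,5,6,8,9,11,15,23)`,
`S = (2,2,2,2,4,2,4,8,16,32)`, `J = 9`, `θ_p = (23·2^(p-6) + 1)/15`, `ρ = 31/2`, `β_pair = 95/2`)
passes — all 14,014 classes, their pair tables and all coverage chains — assembled from the twelve
per-level kernel theorems.  This is the first kernel evidence for paper `gemm.tex` Theorem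
t:thetapmix beyond the decided instances; it becomes the SUP side of t:thetapmix (E2M3×E2M1 row) for
every `p ≥ 10` once the soundness layer of `GemmThetaLawGenDefs` lands (gen 13). [cell]
-/

namespace Literature.ComputerArithmetic.FloatingPoint

namespace MiniFloat

namespace ThetaLaw

/-- The levels of the E2M3×E2M1 law, explicitly. [cell] -/
theorem levels_e2m3e2m1 : e2m3e2m1Law.levels =
    [Lev.Q, Lev.bin 0, Lev.bin 1, Lev.bin 2, Lev.bin 3, Lev.bin 4, Lev.bin 5, Lev.bin 6, Lev.bin 7,
      Lev.bin 8, Lev.bin 9, Lev.top] := by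
  decide

/-- THE E2M3×E2M1 LAW CHECK PASSES for every `p ≥ 10`. [cell, kernel; assembled] -/
theorem lawCheck_e2m3e2m1 : e2m3e2m1Law.lawCheck = true := by
  unfold LawData.lawCheck
  rw [levels_e2m3e2m1, sideOK_e2m3e2m1]
  simp only [List.all_cons, List.all_nil, levCheck_e2m3e2m1_Q, levCheck_e2m3e2m1_b0,
    levCheck_e2m3e2m1_b1, levCheck_e2m3e2m1_b2, levCheck_e2m3e2m1_b3, levCheck_e2m3e2m1_b4,
    levCheck_e2m3e2m1_b5, levCheck_e2m3e2m1_b6, levCheck_e2m3e2m1_b7, levCheck_e2m3e2m1_b8,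
    levCheck_e2m3e2m1_b9, levCheck_e2m3e2m1_top, Bool.and_self]

end ThetaLaw

end MiniFloat

end Literature.ComputerArithmetic.FloatingPoint
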